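import Mathlib.Analysis.InnerProductSpace.PiL2
import Mathlib.Analysis.InnerProductSpace.Trace
import Mathlib.Analysis.Calculus.FDeriv.Symmetric
import Literature.Geometry.Lorentzian.ScalarCurvatureLinearization
import Literature.Analysis.FluidPDE.ShellDivergence
import HarnessLib

/-!
# The ADM flux vector of a trilinear form: frame independence, rotations, curl fields

Support file (all results proved) for Bartnik's uniqueness theorem for the ADM energy
(`Literature.Geometry.Lorentzian.AFEnd.HasADMEnergy.Of_isSameEnd`, Bartnik, CPAM 39 (1986),
Thm. 4.2). The ADM energy flux density field of metric components `G` in an orthonormal frame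
`b` is `V = ∑ᵢ (∑ⱼ (∂ⱼ Gᵢⱼ − ∂ᵢ Gⱼⱼ)) bᵢ` (`ScalarCurvatureLinearization`, `hasFDerivAt_admVec`);
it is the value on `τ = DG(y)` of the linear map

  `admVecOf b τ = ∑ᵢ (∑ⱼ (τ(bⱼ, bᵢ, bⱼ) − τ(bᵢ, bⱼ, bⱼ))) bᵢ`   (`τ : E →L E →L E →L ℝ`).

We prove:

* `inner_admVecOf_left`, `admVecOf_eq_of_orthonormalBasis` — `⟪admVecOf b τ, v⟫ =
  ∑ⱼ (τ(bⱼ, v, bⱼ) − τ(v, bⱼ, bⱼ))` is a difference of traces, so `admVecOf b τ` does not depend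
  on the orthonormal frame (the ADM flux vector `div h − grad tr h` is a tensorial contraction;
  Bartnik 1986, (4.2); Arnowitt–Deser–Misner 1962);
* `admVecOf_rotate` — equivariance under a linear isometry `O`:
  `∑ᵢ (∑ⱼ (τ(Obⱼ, Obᵢ, Obⱼ) − τ(Obᵢ, Obⱼ, Obⱼ))) bᵢ = O⁻¹ (admVecOf b τ)`;
* `norm_admVecOf_le` — `‖admVecOf b τ‖ ≤ 2 |ι|² ‖τ‖`;
* `admVec_eq_admVecOf`, `fderiv_admVec_apply` — the field `V` of `ScalarCurvatureLinearization`
  is `admVecOf b (DG y)` and `DV(x) a = admVecOf b (D²G(x) a)`;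
* `trace_fderiv_admVec_eq_zero_of_antisymm`, `sphereIntegral_admVec_eq_zero_of_antisymm` —
  **curl fields have no flux**: if `β` is an *antisymmetric* `C²` family of bilinear forms then the
  field `c = ∑ᵢ (∑ⱼ ∂ⱼ βᵢⱼ) bᵢ` (its ADM vector) is divergence free, and if moreover `β` vanishes
  on a ball around the origin then the flux of `c` through every round sphere vanishes (Gauss–Green
  on shells, `FluidPDE.setIntegral_shell_divergence_eq`). This is the "curious cancellation" of
  Bartnik 1986, (4.9) (the exact boundary term produced by a change of the structure at infinity),
  in the form used for round coordinate spheres.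

## References

* R. Bartnik, *The mass of an asymptotically flat manifold*, CPAM 39 (1986), §4, (4.2), (4.9).
* R. Arnowitt, S. Deser, C. W. Misner, *The dynamics of general relativity* (1962).
* P. T. Chruściel, *Boundary conditions at spatial infinity from a Hamiltonian point of view*,
  in: Topological properties and global structure of space-time (1986), §2–3.
-/

noncomputable section

-- instance search on the nested operator spaces `E →L[ℝ] E →L[ℝ] E →L[ℝ] ℝ` is deep
set_option maxSynthPendingDepth 3

open Finset Filter ContinuousLinearMap Metric
open _root_.MeasureTheory _root_.MeasureTheory.Measure
open scoped Topology RealInnerProductSpace ContDiff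

namespace Literature.Geometry.Lorentzian

variable {E : Type*} [NormedAddCommGroup E] [InnerProductSpace ℝ E]
  {ι : Type*} [Fintype ι]

/-! ### The ADM vector of a trilinear form -/

/-- The **ADM flux vector of a trilinear form** `τ` in the orthonormal frame `b`:
`admVecOf b τ = ∑ᵢ (∑ⱼ (τ(bⱼ, bᵢ, bⱼ) − τ(bᵢ, bⱼ, bⱼ))) bᵢ`. For `τ = DG(y)` (the derivative of
metric components) this is the ADM energy flux density `∑ᵢ (∑ⱼ (∂ⱼGᵢⱼ − ∂ᵢGⱼⱼ)) bᵢ = div G − ∇ tr G`.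
Bartnik 1986, (4.2); Arnowitt–Deser–Misner 1962. [cite: Bartnik1986, §4, (4.2)] -/
def admVecOf (b : OrthonormalBasis ι ℝ E) (τ : E →L[ℝ] E →L[ℝ] E →L[ℝ] ℝ) : E :=
  ∑ i, (∑ j, (τ (b j) (b i) (b j) - τ (b i) (b j) (b j))) • b i

/-- `admVecOf b` is additive in the form. [folklore] -/
theorem admVecOf_add (b : OrthonormalBasis ι ℝ E) (τ₁ τ₂ : E →L[ℝ] E →L[ℝ] E →L[ℝ] ℝ) :
    admVecOf b (τ₁ + τ₂) = admVecOf b τ₁ + admVecOf b τ₂ := by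
  simp only [admVecOf, ← Finset.sum_add_distrib, ← add_smul]
  refine Finset.sum_congr rfl fun i _ ↦ ?_
  congr 1
  refine Finset.sum_congr rfl fun j _ ↦ ?_
  simp only [_root_.add_apply]
  ring

/-- `admVecOf b` commutes with subtraction of forms. [folklore] -/
theorem admVecOf_sub (b : OrthonormalBasis ι ℝ E) (τ₁ τ₂ : E →L[ℝ] E →L[ℝ] E →L[ℝ] ℝ) :
    admVecOf b (τ₁ - τ₂) = admVecOf b τ₁ - admVecOf b τ₂ := by
  have h := admVecOf_add b (τ₁ - τ₂) τ₂
  rw [sub_add_cancel] at h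
  rw [h, add_sub_cancel_right]

/-- **Norm bound**: `‖admVecOf b τ‖ ≤ 2 |ι|² ‖τ‖` (each entry `|τ(bₐ, b_c, b_d)| ≤ ‖τ‖`). [folklore] -/
theorem norm_admVecOf_le (b : OrthonormalBasis ι ℝ E) (τ : E →L[ℝ] E →L[ℝ] E →L[ℝ] ℝ) :
    ‖admVecOf b τ‖ ≤ 2 * (Fintype.card ι : ℝ) ^ 2 * ‖τ‖ := by
  have hb : ∀ i, ‖b i‖ = 1 := fun i ↦ b.orthonormal.1 i
  have h1 : ∀ a c d : ι, |τ (b a) (b c) (b d)| ≤ ‖τ‖ := by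
    intro a c d
    rw [← Real.norm_eq_abs]
    calc ‖τ (b a) (b c) (b d)‖ ≤ ‖τ (b a) (b c)‖ * ‖b d‖ := le_opNorm _ _
      _ ≤ ‖τ (b a)‖ * ‖b c‖ * ‖b d‖ := by gcongr; exact le_opNorm _ _
      _ ≤ ‖τ‖ * ‖b a‖ * ‖b c‖ * ‖b d‖ := by gcongr; exact le_opNorm _ _
      _ = ‖τ‖ := by simp [hb]
  calc ‖admVecOf b τ‖
      ≤ ∑ i, ‖(∑ j, (τ (b j) (b i) (b j) - τ (b i) (b j) (b j))) • b i‖ := norm_sum_le _ _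
    _ ≤ ∑ _i, ∑ _j, 2 * ‖τ‖ := by
        refine Finset.sum_le_sum fun i _ ↦ ?_
        rw [norm_smul, hb i, mul_one, Real.norm_eq_abs]
        refine (Finset.abs_sum_le_sum_abs _ _).trans (Finset.sum_le_sum fun j _ ↦ ?_)
        calc |τ (b j) (b i) (b j) - τ (b i) (b j) (b j)|
            ≤ |τ (b j) (b i) (b j)| + |τ (b i) (b j) (b j)| := abs_sub _ _
          _ ≤ ‖τ‖ + ‖τ‖ := add_le_add (h1 j i j) (h1 i j j)
          _ = 2 * ‖τ‖ := by ring
    _ = 2 * (Fintype.card ι : ℝ) ^ 2 * ‖τ‖ := by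
        simp only [Finset.sum_const, Finset.card_univ, nsmul_eq_mul]
        ring

/-- **The components of the ADM vector**: `⟪admVecOf b τ, v⟫ = ∑ⱼ (τ(bⱼ, v, bⱼ) − τ(v, bⱼ, bⱼ))`
(expand `v = ∑ᵢ ⟪bᵢ, v⟫ bᵢ` and use linearity of `τ` in its first two slots). [folklore] -/
theorem inner_admVecOf_left (b : OrthonormalBasis ι ℝ E) (τ : E →L[ℝ] E →L[ℝ] E →L[ℝ] ℝ)
    (v : E) : ⟪admVecOf b τ, v⟫ = ∑ j, (τ (b j) v (b j) - τ v (b j) (b j)) := by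
  have hA : ∀ j, ∑ i, τ (b j) (b i) (b j) * ⟪b i, v⟫ = τ (b j) v (b j) := by
    intro j
    have h := congrArg (fun x ↦ τ (b j) x (b j)) (b.sum_repr' v)
    simp only [_root_.map_sum, map_smul, _root_.sum_apply, _root_.smul_apply, smul_eq_mul] at h
    rw [← h]
    exact Finset.sum_congr rfl fun i _ ↦ by ring
  have hB : ∀ j, ∑ i, τ (b i) (b j) (b j) * ⟪b i, v⟫ = τ v (b j) (b j) := by
    intro j
    have h := congrArg (fun x ↦ τ x (b j) (b j)) (b.sum_repr' v)
    simp only [_root_.map_sum, map_smul, _root_.sum_apply, _root_.smul_apply, smul_eq_mul] at h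
    rw [← h]
    exact Finset.sum_congr rfl fun i _ ↦ by ring
  simp only [admVecOf, sum_inner, real_inner_smul_left]
  calc ∑ i, (∑ j, (τ (b j) (b i) (b j) - τ (b i) (b j) (b j))) * ⟪b i, v⟫
      = ∑ i, ∑ j, (τ (b j) (b i) (b j) * ⟪b i, v⟫ - τ (b i) (b j) (b j) * ⟪b i, v⟫) := by
        refine Finset.sum_congr rfl fun i _ ↦ ?_
        rw [Finset.sum_mul]
        exact Finset.sum_congr rfl fun j _ ↦ by ring
    _ = ∑ j, ∑ i, (τ (b j) (b i) (b j) * ⟪b i, v⟫ - τ (b i) (b j) (b j) * ⟪b i, v⟫) :=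
        Finset.sum_comm
    _ = ∑ j, (τ (b j) v (b j) - τ v (b j) (b j)) := by
        refine Finset.sum_congr rfl fun j _ ↦ ?_
        rw [Finset.sum_sub_distrib, hA j, hB j]

/-! ### Frame independence -/

/-- **The trace of a bilinear form is frame independent**: `∑ᵢ B(bᵢ, bᵢ) = ∑ₖ B(b'ₖ, b'ₖ)` for any
two orthonormal bases (both equal the trace of the operator `T` with `⟪v, T w⟫ = B(w, v)`, Mathlib
`LinearMap.trace_eq_sum_inner`). [folklore] -/
theorem sum_apply_self_eq_of_orthonormalBasis [FiniteDimensional ℝ E] {ι' : Type*} [Fintype ι']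
    (B : E →L[ℝ] E →L[ℝ] ℝ) (b : OrthonormalBasis ι ℝ E) (b' : OrthonormalBasis ι' ℝ E) :
    ∑ i, B (b i) (b i) = ∑ k, B (b' k) (b' k) := by
  classical
  -- the operator `T w = ∑ₖ B(w, b'ₖ) b'ₖ` represents `B`: `⟪v, T w⟫ = B(w, v)`
  set T : E →L[ℝ] E := ∑ k, (B.flip (b' k)).smulRight (b' k) with hT
  have hTrep : ∀ v w, ⟪v, T w⟫ = B w v := by
    intro v w
    simp only [hT, _root_.sum_apply, ContinuousLinearMap.smulRight_apply,
      ContinuousLinearMap.flip_apply, inner_sum, inner_smul_right]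
    have h := congrArg (fun x ↦ B w x) (b'.sum_repr' v)
    simp only [_root_.map_sum, map_smul, smul_eq_mul] at h
    rw [← h]
    refine Finset.sum_congr rfl fun k _ ↦ ?_
    rw [real_inner_comm]
    ring
  have h1 : ∑ i, B (b i) (b i) = LinearMap.trace ℝ E (T : E →ₗ[ℝ] E) := by
    rw [LinearMap.trace_eq_sum_inner _ b]
    exact Finset.sum_congr rfl fun i _ ↦ by rw [ContinuousLinearMap.coe_coe, hTrep]
  have h2 : ∑ k, B (b' k) (b' k) = LinearMap.trace ℝ E (T : E →ₗ[ℝ] E) := by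
    rw [LinearMap.trace_eq_sum_inner _ b']
    exact Finset.sum_congr rfl fun k _ ↦ by rw [ContinuousLinearMap.coe_coe, hTrep]
  rw [h1, h2]

/-- **Frame independence of the ADM flux vector**: `admVecOf b τ = admVecOf b' τ` for any two
orthonormal bases (`⟪admVecOf b τ, v⟫` is a difference of two traces). Bartnik 1986, (4.2) (the
flux density `∂ⱼgᵢⱼ − ∂ᵢgⱼⱼ` as a covector). [cite: Bartnik1986, §4, (4.2)] -/
theorem admVecOf_eq_of_orthonormalBasis [FiniteDimensional ℝ E] {ι' : Type*} [Fintype ι']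
    (b : OrthonormalBasis ι ℝ E) (b' : OrthonormalBasis ι' ℝ E)
    (τ : E →L[ℝ] E →L[ℝ] E →L[ℝ] ℝ) : admVecOf b τ = admVecOf b' τ := by
  refine ext_inner_right ℝ fun v ↦ ?_
  rw [inner_admVecOf_left, inner_admVecOf_left, Finset.sum_sub_distrib, Finset.sum_sub_distrib]
  have h1 : ∑ j, τ (b j) v (b j) = ∑ k, τ (b' k) v (b' k) := by
    have := sum_apply_self_eq_of_orthonormalBasis (τ.flip v) b b'
    simpa only [ContinuousLinearMap.flip_apply] using this
  have h2 : ∑ j, τ v (b j) (b j) = ∑ k, τ v (b' k) (b' k) :=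
    sum_apply_self_eq_of_orthonormalBasis (τ v) b b'
  rw [h1, h2]

/-- **Equivariance under linear isometries**: for `O : E ≃ₗᵢ E`,
`∑ᵢ (∑ⱼ (τ(Obⱼ, Obᵢ, Obⱼ) − τ(Obᵢ, Obⱼ, Obⱼ))) bᵢ = O⁻¹ (admVecOf b τ)` (the left side is
`O⁻¹` of the ADM vector in the rotated frame `Ob`, which by frame independence is the ADM vector).
This is the behaviour of the ADM flux density under the rigid motion relating two structures at
infinity, Bartnik 1986, Cor. 3.2 and (4.8). [cite: Bartnik1986, §3, Cor. 3.2] -/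
theorem admVecOf_rotate [FiniteDimensional ℝ E] (b : OrthonormalBasis ι ℝ E) (O : E ≃ₗᵢ[ℝ] E)
    (τ : E →L[ℝ] E →L[ℝ] E →L[ℝ] ℝ) :
    ∑ i, (∑ j, (τ (O (b j)) (O (b i)) (O (b j)) - τ (O (b i)) (O (b j)) (O (b j)))) • b i =
      O.symm (admVecOf b τ) := by
  rw [← admVecOf_eq_of_orthonormalBasis (b.map O) b τ]
  simp only [admVecOf, OrthonormalBasis.map_apply, _root_.map_sum, LinearIsometryEquiv.map_smul,
    LinearIsometryEquiv.symm_apply_apply]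

/-! ### The ADM field of metric components -/

/-- **The ADM field is `admVecOf` of the derivative**: if
`V y = ∑ᵢ (∑ⱼ (∂_{bⱼ}Gᵢⱼ − ∂_{bᵢ}Gⱼⱼ)(y)) bᵢ` and `G` is differentiable at `y`, then
`V y = admVecOf b (DG(y))`. Bartnik 1986, (4.2). [cite: Bartnik1986, §4, (4.2)] -/
theorem admVec_eq_admVecOf {G : E → E →L[ℝ] E →L[ℝ] ℝ} {V : E → E} (b : OrthonormalBasis ι ℝ E)
    (hV : ∀ y, V y = ∑ i, (∑ j, (fderiv ℝ (fun z ↦ G z (b i) (b j)) y (b j) -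
      fderiv ℝ (fun z ↦ G z (b j) (b j)) y (b i))) • b i)
    {y : E} (hG : DifferentiableAt ℝ G y) : V y = admVecOf b (fderiv ℝ G y) := by
  rw [hV y, admVecOf]
  simp only [OpensChart.fderiv_apply₂ G hG]

/-- **The derivative of the ADM field is `admVecOf` of the second derivative**:
`DV(x) a = admVecOf b (D²G(x) a)` at a `C²` point. Bartnik 1986, (4.2)–(4.3). [cite: Bartnik1986, §4, (4.2)–(4.3)] -/
theorem fderiv_admVec_apply {G : E → E →L[ℝ] E →L[ℝ] ℝ} {V : E → E} (b : OrthonormalBasis ι ℝ E)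
    (hV : ∀ y, V y = ∑ i, (∑ j, (fderiv ℝ (fun z ↦ G z (b i) (b j)) y (b j) -
      fderiv ℝ (fun z ↦ G z (b j) (b j)) y (b i))) • b i)
    {x : E} (hG2 : ContDiffAt ℝ 2 G x) (a : E) :
    fderiv ℝ V x a = admVecOf b (fderiv ℝ (fderiv ℝ G) x a) := by
  rw [(hasFDerivAt_admVec b hV hG2).fderiv]
  simp only [admVecOf, _root_.sum_apply, ContinuousLinearMap.smulRight_apply, _root_.sub_apply,
    ContinuousLinearMap.flip_apply]

/-! ### Curl fields have no flux through round spheres -/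

/-- **The ADM vector of an antisymmetric family is divergence free.** If `β` is `C²` at `x` and
antisymmetric (`β(y)(v, w) = −β(y)(w, v)`), then the field `c = ∑ᵢ (∑ⱼ (∂ⱼβᵢⱼ − ∂ᵢβⱼⱼ)) bᵢ =
∑ᵢ (∑ⱼ ∂ⱼβᵢⱼ) bᵢ` has `tr Dc(x) = ∑ᵢₖ ∂ᵢ∂ₖ βᵢₖ = 0` (symmetry of second derivatives against
antisymmetry of `β`). This is `d ∘ d = 0` for the `1`-form `⋆β`; Bartnik 1986, (4.9). [cite: Bartnik1986, §4, (4.9)] -/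
theorem trace_fderiv_admVec_eq_zero_of_antisymm {β : E → E →L[ℝ] E →L[ℝ] ℝ} {c : E → E}
    (b : OrthonormalBasis ι ℝ E)
    (hc : ∀ y, c y = ∑ i, (∑ j, (fderiv ℝ (fun z ↦ β z (b i) (b j)) y (b j) -
      fderiv ℝ (fun z ↦ β z (b j) (b j)) y (b i))) • b i)
    {x : E} (hβ2 : ContDiffAt ℝ 2 β x) (hanti : ∀ y v w, β y v w = -β y w v) :
    LinearMap.trace ℝ E (fderiv ℝ c x : E →ₗ[ℝ] E) = 0 := by
  classical
  rw [trace_fderiv_admVec b hc hβ2]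
  set C := fderiv ℝ (fderiv ℝ β) x with hC
  have S1 : ∀ a u v w : E, C a u v w = C u a v w := fun a u v w ↦ by
    rw [hC, (hβ2.isSymmSndFDerivAt (by rw [minSmoothness_of_isRCLikeNormedField])).eq a u]
  have S2 : ∀ a u v w : E, C a u v w = -C a u w v := fun a u v w ↦ by
    rw [hC, fderiv_fderiv_bilin_apply_eq hβ2, fderiv_fderiv_bilin_apply_eq hβ2]
    have hfun : (fun z ↦ β z v w) = fun z ↦ -β z w v := funext fun z ↦ hanti z v w
    have hder : (fun y ↦ fderiv ℝ (fun z ↦ β z v w) y u) =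
        fun y ↦ -fderiv ℝ (fun z ↦ β z w v) y u := by
      funext y
      rw [hfun, fderiv_fun_neg, _root_.neg_apply]
    rw [hder, fderiv_fun_neg, _root_.neg_apply]
  have hdiag : ∀ a u v : E, C a u v v = 0 := fun a u v ↦ by linarith [S2 a u v v]
  simp only [hdiag, sub_zero]
  have hS : ∑ i, ∑ k, C (b i) (b k) (b i) (b k) = -∑ i, ∑ k, C (b i) (b k) (b i) (b k) := by
    conv_rhs => rw [Finset.sum_comm]
    rw [← Finset.sum_neg_distrib]
    refine Finset.sum_congr rfl fun i _ ↦ ?_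
    rw [← Finset.sum_neg_distrib]
    refine Finset.sum_congr rfl fun k _ ↦ ?_
    rw [S1 (b k) (b i), S2 (b i) (b k) (b k) (b i), neg_neg]
  linarith

/-- **Curl fields have no flux through round spheres** (the "curious cancellation", Bartnik 1986,
(4.9), for round coordinate spheres). Let `β` be a `C²` antisymmetric family of bilinear forms on a
finite-dimensional inner product space, vanishing on the closed ball of radius `R₀ > 0`, and
`c = ∑ᵢ (∑ⱼ (∂ⱼβᵢⱼ − ∂ᵢβⱼⱼ)) bᵢ` its (divergence-free) ADM vector. Then for every `r > 0` the flux
`∫ ⟪x/‖x‖, c(x)⟫|_{x = rα} dσ(α)` vanishes: by Gauss–Green on the shell `{a < ‖x‖ < r}`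
(`FluidPDE.setIntegral_shell_divergence_eq`) the fluxes through `S_r` and `S_a` agree, and `c = 0`
on `S_a` for `a < R₀`. [cite: Bartnik1986, §4, (4.9)] -/
theorem sphereIntegral_admVec_eq_zero_of_antisymm [FiniteDimensional ℝ E] [MeasurableSpace E]
    [BorelSpace E] [Nontrivial E] (μ : Measure E) [μ.IsAddHaarMeasure]
    {β : E → E →L[ℝ] E →L[ℝ] ℝ} {c : E → E} (b : OrthonormalBasis ι ℝ E)
    (hc : ∀ y, c y = ∑ i, (∑ j, (fderiv ℝ (fun z ↦ β z (b i) (b j)) y (b j) -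
      fderiv ℝ (fun z ↦ β z (b j) (b j)) y (b i))) • b i)
    (hβ : ContDiff ℝ 2 β) (hanti : ∀ y v w, β y v w = -β y w v) {R₀ : ℝ} (hR₀ : 0 < R₀)
    (hzero : ∀ y, ‖y‖ ≤ R₀ → β y = 0) {r : ℝ} (hr : 0 < r) :
    Analysis.FluidPDE.sphereIntegral μ (fun x ↦ ⟪‖x‖⁻¹ • x, c x⟫) r = 0 := by
  have hc1 : ContDiff ℝ 1 c := contDiff_iff_contDiffAt.2 fun x ↦
    contDiffAt_admVec b hc hβ.contDiffAt (by norm_num)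
  have htr : ∀ x, LinearMap.trace ℝ E (fderiv ℝ c x : E →ₗ[ℝ] E) = 0 := fun x ↦
    trace_fderiv_admVec_eq_zero_of_antisymm b hc hβ.contDiffAt hanti
  -- `c` vanishes on the open ball of radius `R₀`
  have hc0 : ∀ y, ‖y‖ < R₀ → c y = 0 := by
    intro y hy
    rw [hc y]
    have hd : ∀ v w u : E, fderiv ℝ (fun z ↦ β z v w) y u = 0 := by
      intro v w u
      have hev : (fun z ↦ β z v w) =ᶠ[𝓝 y] fun _ ↦ (0 : ℝ) := by
        filter_upwards [isOpen_ball.mem_nhds (mem_ball_zero_iff.2 hy)] with z hz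
        rw [hzero z (mem_ball_zero_iff.1 hz).le, zero_apply, zero_apply]
      rw [hev.fderiv_eq, fderiv_fun_const, Pi.zero_apply, zero_apply]
    simp only [hd, sub_zero, Finset.sum_const_zero, zero_smul]
  -- the flux through a small sphere vanishes
  set a : ℝ := min r (R₀ / 2) with ha
  have ha0 : 0 < a := lt_min hr (by linarith)
  have har : a ≤ r := min_le_left _ _
  have haR : a < R₀ := (min_le_right _ _).trans_lt (by linarith)
  have hflux_a : Analysis.FluidPDE.sphereIntegral μ (fun x ↦ ⟪‖x‖⁻¹ • x, c x⟫) a = 0 := by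
    rw [Analysis.FluidPDE.sphereIntegral_def]
    refine integral_eq_zero_of_ae (ae_of_all _ fun θ ↦ ?_)
    simp only [Pi.zero_apply]
    rw [hc0 _ (by rw [Analysis.FluidPDE.norm_smul_sphere ha0.le θ]; exact haR), inner_zero_right]
  -- Gauss–Green on the shell `{a < ‖x‖ < r}`
  have key := Analysis.FluidPDE.setIntegral_shell_divergence_eq μ hc1 ha0 har
  simp only [htr, integral_zero, hflux_a, mul_zero, sub_zero] at key
  have hrn : (r ^ (Module.finrank ℝ E - 1) : ℝ) ≠ 0 := pow_ne_zero _ hr.ne'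
  exact (mul_eq_zero.1 key.symm).resolve_left hrn

end Literature.Geometry.Lorentzian

end
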